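import Mathlib
import HarnessLib
import Summits.NavierStokesRegularity.NavierStokesRegularity.Theorems.IsobarTomographyTubeAlternativeStubPeakZoomPatchLineLimit
import Summits.NavierStokesRegularity.NavierStokesRegularity.Theorems.SqueezeCycleExtremalBiaxialitySubcriticalPayerTomography

/-!
# Crux `IsobarTomography.BlobRiccatiClosure` (stmt-NavierStokesRegularity-11740), line
# `type-i-apex-liouville`, stub B `stub_apexZoom` — tools II: the tomography hypotheses at a
# window time and for a Type-I ancient limit

Helper file (theorems only) for the extremal-apex zoom. Stub B2 (`stub_hessianCentreLimit`) passes
the pressure Hessian to the limit at a point under a BUNDLE of hypotheses on the fields (`C⁴`,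
divergence free, Poisson pressure `Δq = −div((v·∇)v)`, uniform bounds on `v`, `∇v`, `∇q`, the
source `G = div((v·∇)v)` and `∇G`). This file discharges that bundle

* for a classical unit-viscosity pair `(w, q)` on a window `(A, 0)` at a time `σ` of the window,
  from bounds on the spatial derivatives of orders `≤ 3` of `w(σ)` and on `∂ₛw(σ, ·)` — the
  registered sub-goal `stub_windowTomographyBundle` (pressure gradient by
  `norm_gradient_le_of_classical`, source by `norm_iteratedFDeriv_pressureSource_le`);
* for a Type-I ancient mild field with a classical pressure on `(−∞, 0)` at any `σ < 0`
  (`exists_ancientTomographyBundle`: the class-uniform gauge bounds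
  `exists_gauge_norm_fderiv_le_of_typeI`, `exists_gauge_norm_fderiv_pressure_le_of_typeI`,
  `exists_source_bounds` of the SqueezeCycle tomography files);

and records the Type-I window bound of a blowing-up velocity (`exists_typeI_window_bound`) and the
pressure Poisson identities `Δp = −div((u·∇)u) = −tr(∇u)²` for classical pairs.

References: Koch–Nadirashvili–Seregin–Šverák, Acta Math. 203 (2009), Prop. 4.1
[KochNadirashviliSereginSverak2009]; folklore.
-/

noncomputable section

open Set Filter Topology Function MeasureTheory Metric
open scoped RealInnerProductSpace NNReal ContDiff

-- the summit and its single sub-problem share the name (CONVENTIONS §1), as in every Theorems file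
set_option linter.dupNamespace false

-- nested operator types `ℝ³ →L[ℝ] ℝ³ →L[ℝ] ℝ`
set_option maxSynthPendingDepth 4

namespace Summit.NavierStokesRegularity.NavierStokesRegularity.Theorems.BlobRiccatiClosure.TypeIApexLiouville

open Literature.Analysis Literature.Analysis.FluidPDE
open Summit.NavierStokesRegularity.NavierStokesRegularity.Theorems
open Summit.NavierStokesRegularity.NavierStokesRegularity.Theorems.TubeAlternative.AnalyticPropagation

/-! ### Pressure Poisson identities and source bounds -/

/-- **Bounds for the pressure source `G = div((v·∇)v)` and its gradient** from bounds on the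
derivatives of orders `≤ 3` of a smooth divergence-free field `v` (`G = ∂ᵢ∂ⱼ(vᵢvⱼ)` for
`div v = 0`; `norm_iteratedFDeriv_pressureSource_le`). [folklore] -/
theorem source_bounds_of_jet {v : EuclideanSpace ℝ (Fin 3) → EuclideanSpace ℝ (Fin 3)}
    (hv : ContDiff ℝ ∞ v) (hdiv : VectorCalculus.IsDivFree v) {Bm : ℝ} (hBm0 : 0 ≤ Bm)
    (hB : ∀ j ≤ 3, ∀ y, ‖iteratedFDeriv ℝ j v y‖ ≤ Bm) :
    (∀ y, ‖VectorCalculus.divergence (convect v v) y‖ ≤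
      ‖(traceCLM : (EuclideanSpace ℝ (Fin 3) →L[ℝ] EuclideanSpace ℝ (Fin 3)) →L[ℝ] ℝ)‖ *
        ((1 + ‖(traceCLM : (EuclideanSpace ℝ (Fin 3) →L[ℝ] EuclideanSpace ℝ (Fin 3)) →L[ℝ] ℝ)‖) *
          (2 ^ (0 + 1) * Bm ^ 2))) ∧
    (∀ y, ‖fderiv ℝ (VectorCalculus.divergence (convect v v)) y‖ ≤
      ‖(traceCLM : (EuclideanSpace ℝ (Fin 3) →L[ℝ] EuclideanSpace ℝ (Fin 3)) →L[ℝ] ℝ)‖ *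
        ((1 + ‖(traceCLM : (EuclideanSpace ℝ (Fin 3) →L[ℝ] EuclideanSpace ℝ (Fin 3)) →L[ℝ] ℝ)‖) *
          (2 ^ (1 + 1) * Bm ^ 2))) := by
  have hG : pressureSource v = VectorCalculus.divergence (convect v v) :=
    pressureSource_eq_of_isDivFree hdiv
  refine ⟨fun y => ?_, fun y => ?_⟩
  · have h := SymmetricScarExists.LogtimeBernoulli.norm_iteratedFDeriv_pressureSource_le hv 0
      hBm0 y (fun j hj => hB j (by omega) y)
    rw [norm_iteratedFDeriv_zero, hG] at h
    exact h
  · have h := SymmetricScarExists.LogtimeBernoulli.norm_iteratedFDeriv_pressureSource_le hv 1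
      hBm0 y (fun j hj => hB j (by omega) y)
    rw [← norm_iteratedFDeriv_fderiv, norm_iteratedFDeriv_zero, hG] at h
    exact h

/-- The Laplacian of a classical pressure at an interior time is minus the trace of the square of
the velocity gradient: `Δp(t)(y) = −tr (∇u(t)(y))²` (pressure Poisson equation for `div u = 0`,
`f = 0`). [folklore] -/
theorem laplacian_pressure_eq_neg_trace {S : Set ℝ} (hS : IsOpen S)
    {u : ℝ → EuclideanSpace ℝ (Fin 3) → EuclideanSpace ℝ (Fin 3)}
    {p : ℝ → EuclideanSpace ℝ (Fin 3) → ℝ} (h : IsClassicalNSSolutionOn S 1 0 u p) {t : ℝ}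
    (ht : t ∈ S) (y : EuclideanSpace ℝ (Fin 3)) :
    Laplacian.laplacian (p t) y = -traceCLM ((fderiv ℝ (u t) y).comp (fderiv ℝ (u t) y)) := by
  have h1 := laplacian_pressure_eq_of_isClassicalNSSolutionOn h (by rwa [hS.interior_eq]) y
  rw [h1, divergence_convect_self_eq ((h.contDiff_velocity ht).of_le (by norm_cast))
    (h.divFree t ht) y]
  simp [VectorCalculus.divergence]

/-- The Laplacian of a classical pressure is minus the pressure source (pressure Poisson equation,
`f = 0`). [folklore] -/
theorem laplacian_pressure_eq_neg_divergence {S : Set ℝ} (hS : IsOpen S)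
    {u : ℝ → EuclideanSpace ℝ (Fin 3) → EuclideanSpace ℝ (Fin 3)}
    {p : ℝ → EuclideanSpace ℝ (Fin 3) → ℝ} (h : IsClassicalNSSolutionOn S 1 0 u p) {t : ℝ}
    (ht : t ∈ S) (y : EuclideanSpace ℝ (Fin 3)) :
    Laplacian.laplacian (p t) y = -VectorCalculus.divergence (convect (u t) (u t)) y := by
  have h1 := laplacian_pressure_eq_of_isClassicalNSSolutionOn h (by rwa [hS.interior_eq]) y
  rw [h1]
  simp [VectorCalculus.divergence]

/-! ### The Type-I window bound of a blowing-up velocity -/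

/-- A velocity blowing up at the Type-I rate at `T > 0` obeys `√(T − t)‖u(t, x)‖ ≤ C₀` on a final
window `(T − δ, T)`, `0 < δ ≤ T` (unfolding `IsTypeIBlowup`). [folklore] -/
theorem exists_typeI_window_bound {T : ℝ} (hT : 0 < T)
    {u : ℝ → EuclideanSpace ℝ (Fin 3) → EuclideanSpace ℝ (Fin 3)} (hI : IsTypeIBlowup u T) :
    ∃ C₀ δ : ℝ, 0 < δ ∧ δ ≤ T ∧
      ∀ t ∈ Ioo (T - δ) T, ∀ x, Real.sqrt (T - t) * ‖u t x‖ ≤ C₀ := by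
  obtain ⟨C', hC'⟩ := hI
  obtain ⟨T₁, hT₁T, hT₁⟩ := mem_nhdsLT_iff_exists_Ioo_subset.1 hC'
  refine ⟨C', min (T - T₁) T, lt_min (sub_pos.2 hT₁T) hT, min_le_right _ _, fun t ht x => ?_⟩
  have hpos : 0 < Real.sqrt (T - t) := Real.sqrt_pos.2 (sub_pos.2 ht.2)
  have h1 : ‖u t x‖ ≤ C' / Real.sqrt (T - t) :=
    hT₁ ⟨by linarith [ht.1, min_le_left (T - T₁) T], ht.2⟩ x
  calc Real.sqrt (T - t) * ‖u t x‖ ≤ Real.sqrt (T - t) * (C' / Real.sqrt (T - t)) :=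
        mul_le_mul_of_nonneg_left h1 hpos.le
    _ = C' := by field_simp

/-! ### Registered sub-goal: the tomography bundle at a window time -/

/-- **Registered sub-goal `stub_windowTomographyBundle`** (line `type-i-apex-liouville`, tools of
stub B). For a classical unit-viscosity pair `(w, q)` on a window `(A, 0)` and a time `σ` of the
window, bounds `K₀, …, K₃` on the spatial derivatives of orders `≤ 3` of `w(σ)` and `L` on
`∂ₛw(σ, ·)` yield the hypotheses of the tomography limit B2 at `σ`: `w(σ), q(σ) ∈ C⁴`, `w(σ)`
divergence free, `Δq(σ) = −div((w·∇)w)(σ)`, `‖∇q(σ)‖ ≤ 3K₂ + K₁K₀ + L`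
(`∇q = Δw − (w·∇)w − ∂ₛw`), and `|G|, ‖∇G‖` bounded for `G = div((w·∇)w)(σ)` in terms of
`B = max(K₀, …, K₃, 0)` and `‖tr‖`. [folklore] -/
theorem stub_windowTomographyBundle :
    ∀ (A σ K₀ K₁ K₂ K₃ L : ℝ) (w : ℝ → EuclideanSpace ℝ (Fin 3) → EuclideanSpace ℝ (Fin 3)) (q : ℝ → EuclideanSpace ℝ (Fin 3) → ℝ),
      IsClassicalNSSolutionOn (Ioo A 0) 1 0 w q → σ ∈ Ioo A 0 →
      (∀ y, ‖w σ y‖ ≤ K₀) → (∀ y, ‖fderiv ℝ (w σ) y‖ ≤ K₁) →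
      (∀ y, ‖iteratedFDeriv ℝ 2 (w σ) y‖ ≤ K₂) → (∀ y, ‖iteratedFDeriv ℝ 3 (w σ) y‖ ≤ K₃) →
      (∀ y, ‖deriv (fun s => w s y) σ‖ ≤ L) →
      ContDiff ℝ 4 (w σ) ∧ VectorCalculus.IsDivFree (w σ) ∧ ContDiff ℝ 4 (q σ) ∧
      (∀ y, Laplacian.laplacian (q σ) y = -VectorCalculus.divergence (convect (w σ) (w σ)) y) ∧
      (∀ y, ‖fderiv ℝ (q σ) y‖ ≤ 3 * K₂ + K₁ * K₀ + L) ∧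
      (∀ y, ‖VectorCalculus.divergence (convect (w σ) (w σ)) y‖ ≤
        ‖(traceCLM : (EuclideanSpace ℝ (Fin 3) →L[ℝ] EuclideanSpace ℝ (Fin 3)) →L[ℝ] ℝ)‖ *
          ((1 + ‖(traceCLM : (EuclideanSpace ℝ (Fin 3) →L[ℝ] EuclideanSpace ℝ (Fin 3)) →L[ℝ] ℝ)‖) *
            (2 ^ (0 + 1) * (max (max (max K₀ K₁) (max K₂ K₃)) 0) ^ 2))) ∧
      (∀ y, ‖fderiv ℝ (VectorCalculus.divergence (convect (w σ) (w σ))) y‖ ≤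
        ‖(traceCLM : (EuclideanSpace ℝ (Fin 3) →L[ℝ] EuclideanSpace ℝ (Fin 3)) →L[ℝ] ℝ)‖ *
          ((1 + ‖(traceCLM : (EuclideanSpace ℝ (Fin 3) →L[ℝ] EuclideanSpace ℝ (Fin 3)) →L[ℝ] ℝ)‖) *
            (2 ^ (1 + 1) * (max (max (max K₀ K₁) (max K₂ K₃)) 0) ^ 2))) := by
  intro A σ K₀ K₁ K₂ K₃ L w q hcl hσS h0 h1 h2 h3 hLt
  have hsm : ContDiff ℝ ∞ (w σ) := hcl.contDiff_velocity hσS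
  have hdiv : VectorCalculus.IsDivFree (w σ) := hcl.divFree σ hσS
  set Bm : ℝ := max (max (max K₀ K₁) (max K₂ K₃)) 0 with hBm
  have hBm0 : 0 ≤ Bm := le_max_right _ _
  have hBj : ∀ i ≤ 3, ∀ y, ‖iteratedFDeriv ℝ i (w σ) y‖ ≤ Bm := by
    intro i hi y
    interval_cases i
    · rw [norm_iteratedFDeriv_zero]
      exact (h0 y).trans ((le_max_left _ _).trans ((le_max_left _ _).trans (le_max_left _ _)))
    · rw [norm_iteratedFDeriv_one]
      exact (h1 y).trans ((le_max_right _ _).trans ((le_max_left _ _).trans (le_max_left _ _)))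
    · exact (h2 y).trans ((le_max_left _ _).trans ((le_max_right _ _).trans (le_max_left _ _)))
    · exact (h3 y).trans ((le_max_right _ _).trans ((le_max_right _ _).trans (le_max_left _ _)))
  obtain ⟨hS, hL⟩ := source_bounds_of_jet hsm hdiv hBm0 hBj
  refine ⟨contDiff_infty.1 hsm 4, hdiv, contDiff_infty.1 (hcl.contDiff_pressure hσS) 4,
    fun y => laplacian_pressure_eq_neg_divergence isOpen_Ioo hcl hσS y, fun y => ?_, hS, hL⟩
  have h := norm_gradient_le_of_classical isOpen_Ioo hcl hσS (h0 y) (h1 y) (h2 y) (hLt y)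
  rwa [gradient, LinearIsometryEquiv.norm_map] at h

/-! ### The tomography bundle for a Type-I ancient mild field -/

/-- **The tomography bundle for a Type-I ancient mild field** with a classical pressure on
`(−∞, 0)`, at any `σ < 0`: `W(σ), q(σ) ∈ C⁴`, `W(σ)` divergence free, `Δq(σ) = −div((W·∇)W)(σ)`,
and bounds on `W(σ)`, `∇W(σ)`, `∇q(σ)`, the source and its gradient (class-uniform gauge bounds of
the SqueezeCycle tomography files, KNSS 2009 Prop. 4.1). [cite: KochNadirashviliSereginSverak2009, Prop. 4.1 (4.10)–(4.11) (arXiv:0709.3599 p. 8)] -/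
theorem exists_ancientTomographyBundle {C : ℝ}
    {W : ℝ → EuclideanSpace ℝ (Fin 3) → EuclideanSpace ℝ (Fin 3)}
    {qW : ℝ → EuclideanSpace ℝ (Fin 3) → ℝ} (hW : IsTypeIAncientMild C W)
    (hWcl : IsClassicalNSSolutionOn (Iio 0) 1 0 W qW) {σ : ℝ} (hσ0 : σ < 0) :
    ∃ M M₁ B S L : ℝ, ContDiff ℝ 4 (W σ) ∧ VectorCalculus.IsDivFree (W σ) ∧ ContDiff ℝ 4 (qW σ) ∧
      (∀ y, ‖W σ y‖ ≤ M) ∧ (∀ y, ‖fderiv ℝ (W σ) y‖ ≤ M₁) ∧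
      (∀ y, Laplacian.laplacian (qW σ) y = -VectorCalculus.divergence (convect (W σ) (W σ)) y) ∧
      (∀ y, ‖fderiv ℝ (qW σ) y‖ ≤ B) ∧
      (∀ y, ‖VectorCalculus.divergence (convect (W σ) (W σ)) y‖ ≤ S) ∧
      (∀ y, ‖fderiv ℝ (VectorCalculus.divergence (convect (W σ) (W σ))) y‖ ≤ L) := by
  obtain ⟨K₀', hK₀'⟩ := exists_gauge_norm_fderiv_le_of_typeI C
  obtain ⟨B₀, -, hB₀⟩ := exists_gauge_norm_fderiv_pressure_le_of_typeI C
  obtain ⟨S', L', hS', hL'⟩ := exists_source_bounds hW hσ0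
  have hWcl' : IsClassicalNSSolutionOn (Ioo (σ - 1) 0) 1 0 W qW :=
    hWcl.mono Ioo_subset_Iio_self isOpen_Ioo.uniqueDiffOn
  have hσpos : 0 < -σ := neg_pos.2 hσ0
  have hσI : σ ∈ Iio 0 := hσ0
  refine ⟨C / Real.sqrt (-σ), K₀' / (-σ), B₀ / Real.sqrt (-σ) ^ 3, S', L',
    contDiff_infty.1 (hW.contDiff_slice hσ0) 4, hW.isDivFree hσ0,
    contDiff_infty.1 (hWcl.contDiff_pressure hσI) 4, fun y => hW.norm_le hσ0 y, fun y => ?_,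
    fun y => laplacian_pressure_eq_neg_divergence isOpen_Iio hWcl hσI y, fun y => ?_, hS', hL'⟩
  · rw [le_div_iff₀ hσpos, mul_comm]
    exact hK₀' hW σ hσ0 y
  · rw [le_div_iff₀ (by positivity), mul_comm]
    exact hB₀ hW (σ - 1) qW hWcl' σ (by linarith) hσ0 y

end Summit.NavierStokesRegularity.NavierStokesRegularity.Theorems.BlobRiccatiClosure.TypeIApexLiouville

end
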